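import Summits.BirchSwinnertonDyer.BirchSwinnertonDyer.Theorems.ManinLocalTwoThreeTranslationNewform
import Summits.BirchSwinnertonDyer.BirchSwinnertonDyer.Theorems.ManinLocalTwoThreeConwayDepthTransfer
import HarnessLib

/-!
# `ConwayDepthTransfer` and `RamanujanDepthTransfer` HOLD (desc g5 support rows of the Conway / Ramanujan cuts)

Summit `BirchSwinnertonDyer`, route `ManinLocalTwoThree` (cell bsd-f2-manin), cruxes C2 `ManinOddAtFour`
(stmt-BirchSwinnertonDyer-22967: Conway cut at `2`, `4 ∣ N`) and C3 `ManinPrimeToThreeAtNine`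
(stmt-BirchSwinnertonDyer-22968: Ramanujan cut at `3`, `9 ∣ N`).  Rows of record:
`Summits/BirchSwinnertonDyer/Rank1Residual/ManinAdditive/ConwayCut.lean` (`@[conjecture] ConwayDepthTransfer`, desc g5,
MEMO-desc §22; refuter-1 §R53 P7: «TRUE on paper at `4 ∣ N` (`a₂ = 0 ⇒ t f = −f`, `w_{Q_p} f = ±f ⇒ ℤf ≤ S^G`,
`e_f S^G` cyclic) … so a prover lands `ConwayDepthTransfer_holds`») and `…/RamanujanCut.lean`
(`@[conjecture] RamanujanDepthTransfer`, «prover-sized»).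

Assembly of two tree pieces: p3's bookkeeping + conditional closer (`Theorems/ManinLocalTwoThreeConwayDepthTransfer.lean`,
p625467: `exists_mem_petersson_eq_of_lineIndex_ne_zero`, `conwayDepthTransfer_of_newform_mem` GIVEN `D.f ∈ S^G`) and
this seat's newform membership (`Theorems/ManinLocalTwoThreeTranslationNewform.lean`: `f_mem_conwayStableLattice`,
`f_mem_ramanujanStableLattice`, from `t f = −f`, `R₃ f = −f`, `w_Q f = ±f`):

* **`ConwayDepthTransfer_holds : ConwayCut.ConwayDepthTransfer`**;
* `ramanujanDepthTransfer_of_mem` (the `3`-adic twin of `conwayDepthTransfer_of_mem`) and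
  **`RamanujanDepthTransfer_holds : RamanujanCut.RamanujanDepthTransfer`**;
* desc's PROVED chains with the transfer hypothesis `hT` discharged — the primed corollaries
  `not_two_dvd_maninConstant_of_conwayDepth'`, `lieSaturatedAt_two_of_conwayDepth'`,
  `not_two_dvd_maninConstant_of_identityComponentTorsion'`, `not_three_dvd_maninConstant_of_ramanujanDepth'`,
  `not_three_dvd_maninConstant_of_smallTypeAtThree'`, `not_three_dvd_maninConstant_of_not_bigStar'` (they remain
  conditional on the GIVEN rows E-desc-28♯ / E-desc-37 and the laws E-desc-31 / E-desc-35 / E-desc-42).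

No new definitions, no named fact, no sorry.  HONEST FRAMING: nothing about BSD or Manin's conjecture is proved here;
C2/C3 remain open.

References: A. Agashe, K. Ribet, W. Stein, *The modular degree, congruence primes, and multiplicity one* (2012), §2.1
[cite: AgasheRibetStein2012, §2.1]; cell memo HOME/MEMO-desc.md §22; refuter-1 report HOME/ref1/R53-ref1-desc-g5.md (P7).
-/


set_option linter.dupNamespace false

noncomputable section

open scoped MatrixGroups ModularForm Real

open CongruenceSubgroup Matrix.SpecialLinearGroup UpperHalfPlane Complex Matrix.GeneralLinearGroup
  Literature.NumberTheory.EllipticCurves.ModularForms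
  Summit.BirchSwinnertonDyer.Rank1Residual.ManinAdditive
  Summit.BirchSwinnertonDyer.Rank1Residual.ManinAdditive.ConwayCut
  Summit.BirchSwinnertonDyer.Rank1Residual.ManinAdditive.RamanujanCut

namespace Summit.BirchSwinnertonDyer.BirchSwinnertonDyer.Theorems.ManinLocalTwoThree

/-! ### §6. `ConwayDepthTransfer` and `RamanujanDepthTransfer` hold -/

section Transfer

/-- **`ConwayDepthTransfer` holds** (desc g5 support row of `ConwayCut.lean`, refuter-1 §R53 P7): p3's conditional
closer `conwayDepthTransfer_of_newform_mem` (bookkeeping `exists_mem_petersson_eq_of_lineIndex_ne_zero`, p625467) fed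
with the newform membership `f_mem_conwayStableLattice` (`t f = −f`, `w_Q f = ±f`; sibling file
`ManinLocalTwoThreeTranslationNewform.lean`).  Nothing about BSD or Manin's conjecture is proved here (the GIVEN row
`IsConwayNeronAtTwo` stays a hypothesis of the row). -/
theorem ConwayDepthTransfer_holds : ConwayCut.ConwayDepthTransfer :=
  conwayDepthTransfer_of_newform_mem fun _ _ _ _ D h4 ↦ f_mem_conwayStableLattice h4 D

/-- The `3`-adic twin of p3's `conwayDepthTransfer_of_mem`: `D.f ∈ S^R`, the GIVEN row at `3`, finite `f`-line index
with full `3`-adic depth ⟹ Néron congruence depth at `3` (bookkeeping `exists_mem_petersson_eq_of_lineIndex_ne_zero`;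
a prime-to-`3` multiple `k • m₀ ∈ Λ`, `q = k/r`, `ord₃ q = −ord₃ r = −ord₃ deg φ`). [cite: AgasheRibetStein2012, §2.1] -/
theorem ramanujanDepthTransfer_of_mem {N : ℕ} [NeZero N] {W : WeierstrassCurve ℚ} [W.IsElliptic]
    {D : ModularParametrizationData W N} (Δ : NeronFLineDatum W D)
    (hfM : D.f ∈ RamanujanCut.ramanujanStableLattice N) (hΛ : RamanujanCut.IsRamanujanNeronAtThree Δ)
    (hv : padicValNat 3 (lineIndex (RamanujanCut.ramanujanStableLattice N) D.f) = padicValNat 3 D.modularDegree)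
    (hr : lineIndex (RamanujanCut.ramanujanStableLattice N) D.f ≠ 0) : Δ.NeronCongruenceDepthAt 3 := by
  obtain ⟨m₀, hm₀, hθ⟩ := exists_mem_petersson_eq_of_lineIndex_ne_zero (RamanujanCut.ramanujanStableLattice N) D.f
    hfM Δ.petersson_self_ne_zero hr
  obtain ⟨k, hk, hkm⟩ := hΛ.2 m₀ hm₀
  set r := lineIndex (RamanujanCut.ramanujanStableLattice N) D.f with hrdef
  have hkne : k ≠ 0 := by rintro rfl; exact hk (dvd_zero 3)
  refine ⟨⟨(k : ℤ) • m₀, hkm⟩, (k : ℚ) / r, div_ne_zero (by exact_mod_cast hkne) (by exact_mod_cast hr), ?_, ?_⟩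
  · have hrC : (r : ℂ) ≠ 0 := by exact_mod_cast hr
    change (((k : ℚ) / r : ℚ) : ℂ) * peterssonProduct (Gamma0 N) 2 D.f D.f =
      peterssonProduct (Gamma0 N) 2 D.f ((k : ℤ) • m₀)
    rw [← peterssonProductₗ_apply D.f ((k : ℤ) • m₀), map_zsmul, peterssonProductₗ_apply, zsmul_eq_mul, ← hθ]
    push_cast
    field_simp
  · haveI : Fact (Nat.Prime 3) := ⟨Nat.prime_three⟩
    rw [padicValRat.div (by exact_mod_cast hkne) (by exact_mod_cast hr), ← hv, padicValRat.of_nat,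
      padicValRat.of_nat, padicValNat.eq_zero_of_not_dvd hk]
    simp

/-- **`RamanujanDepthTransfer` holds** (desc g5 support row of `RamanujanCut.lean`): `D.f ∈ S^R` at `9 ∣ N` by
`R₃ f = −f` (`f_mem_ramanujanStableLattice`).  Nothing about BSD or Manin's conjecture is proved here. -/
theorem RamanujanDepthTransfer_holds : RamanujanCut.RamanujanDepthTransfer := by
  intro N _ W _ D Δ h9 hΛ hv hr
  exact ramanujanDepthTransfer_of_mem Δ (f_mem_ramanujanStableLattice h9 D) hΛ hv hr

/-! #### The desc chains with the transfer hypothesis discharged -/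

/-- desc's `not_two_dvd_maninConstant_of_conwayDepth` with `hT` discharged: GIVEN row at `2` + full Conway depth
⇒ `2 ∤ c_E`. -/
theorem not_two_dvd_maninConstant_of_conwayDepth' {N : ℕ} [NeZero N] {W : WeierstrassCurve ℚ} [W.IsElliptic]
    {D : ModularParametrizationData W N} (Δ : NeronFLineDatum W D) (h4 : 4 ∣ N)
    (hΛ : ConwayCut.IsConwayNeronAtTwo Δ)
    (hfull : padicValNat 2 (lineIndex (ConwayCut.conwayStableLattice N) D.f) = padicValNat 2 D.modularDegree)
    (hfin : lineIndex (ConwayCut.conwayStableLattice N) D.f ≠ 0) :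
    ¬ (2 : ℤ) ∣ D.maninConstant :=
  ConwayCut.not_two_dvd_maninConstant_of_conwayDepth ConwayDepthTransfer_holds Δ h4 hΛ hfull hfin

/-- desc's `lieSaturatedAt_two_of_conwayDepth` with `hT` discharged. -/
theorem lieSaturatedAt_two_of_conwayDepth' {N : ℕ} [NeZero N] {W : WeierstrassCurve ℚ} [W.IsElliptic]
    {D : ModularParametrizationData W N} (Δ : NeronFLineDatum W D) (h4 : 4 ∣ N)
    (hΛ : ConwayCut.IsConwayNeronAtTwo Δ)
    (hfull : padicValNat 2 (lineIndex (ConwayCut.conwayStableLattice N) D.f) = padicValNat 2 D.modularDegree)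
    (hfin : lineIndex (ConwayCut.conwayStableLattice N) D.f ≠ 0) :
    Δ.LieSaturatedAt 2 :=
  ConwayCut.lieSaturatedAt_two_of_conwayDepth ConwayDepthTransfer_holds Δ h4 hΛ hfull hfin

/-- desc's CHAIN `not_two_dvd_maninConstant_of_identityComponentTorsion` (E-desc-31 + GIVEN ⇒ `2 ∤ c_E`) with the
transfer discharged: conditional only on the law E-desc-31 and the GIVEN row E-desc-28♯. -/
theorem not_two_dvd_maninConstant_of_identityComponentTorsion'
    (hLaw : ConwayCut.ConwayFullOfIdentityComponentTorsion)
    (W : WeierstrassCurve ℚ) [W.IsElliptic] [W.IsGloballyMinimal] [NeZero (W.conductorNorm ℤ)]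
    (D : ModularParametrizationData W (W.conductorNorm ℤ)) (Δ : NeronFLineDatum W D)
    (hL : ∀ z ∈ D.L.lattice, ∃ w ∈ periodLattice D.f, z = D.c * w)
    (hopt : ∀ (W' : WeierstrassCurve ℚ) [W'.IsElliptic]
        (D' : ModularParametrizationData W' (W.conductorNorm ℤ)),
        D'.f = D.f → D.modularDegree ≤ D'.modularDegree)
    (h4 : 4 ∣ W.conductorNorm ℤ) (htors : ConwayCut.HasTwoTorsionInIdentityComponentAtTwo W)
    (hΛ : ConwayCut.IsConwayNeronAtTwo Δ)
    (hfin : lineIndex (ConwayCut.conwayStableLattice (W.conductorNorm ℤ)) D.f ≠ 0) :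
    ¬ (2 : ℤ) ∣ D.maninConstant :=
  ConwayCut.not_two_dvd_maninConstant_of_identityComponentTorsion hLaw ConwayDepthTransfer_holds W D Δ hL hopt
    h4 htors hΛ hfin

/-- desc's `not_three_dvd_maninConstant_of_ramanujanDepth` with `hT` discharged: GIVEN row at `3` + full
Ramanujan depth ⇒ `3 ∤ c_E`. -/
theorem not_three_dvd_maninConstant_of_ramanujanDepth' {N : ℕ} [NeZero N] {W : WeierstrassCurve ℚ}
    [W.IsElliptic] {D : ModularParametrizationData W N} (Δ : NeronFLineDatum W D) (h9 : 9 ∣ N)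
    (hΛ : RamanujanCut.IsRamanujanNeronAtThree Δ)
    (hfull : padicValNat 3 (lineIndex (RamanujanCut.ramanujanStableLattice N) D.f) =
      padicValNat 3 D.modularDegree)
    (hfin : lineIndex (RamanujanCut.ramanujanStableLattice N) D.f ≠ 0) :
    ¬ (3 : ℤ) ∣ D.maninConstant :=
  RamanujanCut.not_three_dvd_maninConstant_of_ramanujanDepth Δ RamanujanDepthTransfer_holds h9 hΛ hfull hfin

/-- desc's CHAIN `not_three_dvd_maninConstant_of_smallTypeAtThree` (E-desc-35 `ThreeStarDefectLaw` + GIVEN ⇒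
`3 ∤ c_E` off II*/III*) with the transfer discharged. -/
theorem not_three_dvd_maninConstant_of_smallTypeAtThree'
    (hLaw : RamanujanCut.ThreeStarDefectLaw)
    (W : WeierstrassCurve ℚ) [W.IsElliptic] [W.IsGloballyMinimal] [NeZero (W.conductorNorm ℤ)]
    (D : ModularParametrizationData W (W.conductorNorm ℤ)) (Δ : NeronFLineDatum W D)
    (hL : ∀ z ∈ D.L.lattice, ∃ w ∈ periodLattice D.f, z = D.c * w)
    (hopt : ∀ (W' : WeierstrassCurve ℚ) [W'.IsElliptic]
        (D' : ModularParametrizationData W' (W.conductorNorm ℤ)),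
        D'.f = D.f → D.modularDegree ≤ D'.modularDegree)
    (h9 : 9 ∣ W.conductorNorm ℤ) (hsmall : ¬ RamanujanCut.IsLargeStarAtThree W)
    (hΛ : RamanujanCut.IsRamanujanNeronAtThree Δ)
    (hfin : lineIndex (RamanujanCut.ramanujanStableLattice (W.conductorNorm ℤ)) D.f ≠ 0) :
    ¬ (3 : ℤ) ∣ D.maninConstant :=
  RamanujanCut.not_three_dvd_maninConstant_of_smallTypeAtThree hLaw RamanujanDepthTransfer_holds W D Δ hL hopt
    h9 hsmall hΛ hfin

/-- desc g6's CHAIN `not_three_dvd_maninConstant_of_not_bigStar` (E-desc-42 `SmallTypeFullLawAtThree` + GIVEN ⇒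
`3 ∤ c_E` off the big-star types) with the transfer discharged. -/
theorem not_three_dvd_maninConstant_of_not_bigStar'
    (hLaw : RamanujanCut.SmallTypeFullLawAtThree)
    (W : WeierstrassCurve ℚ) [W.IsElliptic] [W.IsGloballyMinimal] [NeZero (W.conductorNorm ℤ)]
    (D : ModularParametrizationData W (W.conductorNorm ℤ)) (Δ : NeronFLineDatum W D)
    (hL : ∀ z ∈ D.L.lattice, ∃ w ∈ periodLattice D.f, z = D.c * w)
    (hopt : ∀ (W' : WeierstrassCurve ℚ) [W'.IsElliptic]
        (D' : ModularParametrizationData W' (W.conductorNorm ℤ)),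
        D'.f = D.f → D.modularDegree ≤ D'.modularDegree)
    (h9 : 9 ∣ W.conductorNorm ℤ) (hsmall : ¬ RamanujanCut.IsBigStarAtThree W)
    (hΛ : RamanujanCut.IsRamanujanNeronAtThree Δ)
    (hfin : lineIndex (RamanujanCut.ramanujanStableLattice (W.conductorNorm ℤ)) D.f ≠ 0) :
    ¬ (3 : ℤ) ∣ D.maninConstant :=
  RamanujanCut.not_three_dvd_maninConstant_of_not_bigStar hLaw RamanujanDepthTransfer_holds W D Δ hL hopt
    h9 hsmall hΛ hfin

end Transfer

end Summit.BirchSwinnertonDyer.BirchSwinnertonDyer.Theorems.ManinLocalTwoThree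

end
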